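import Summits.NavierStokesRegularity.NavierStokesRegularity.Theses.HodographBetchov
import Summits.NavierStokesRegularity.NavierStokesRegularity.Theorems.HodographBetchovHodographConditioningMollify
import Mathlib.MeasureTheory.Measure.HasOuterApproxClosed
import Mathlib.Analysis.Calculus.InverseFunctionTheorem.FDeriv

/-!
# Support item `HodographBetchov.HodographConditioning` (stmt-NavierStokesRegularity-15834) — PROVED

HODOGRAPH CONDITIONING (card P1(b) of route `HodographBetchov`): for `u ∈ C¹(ℝ³; ℝ³)` tending to
`0` at infinity with `det ∇u ∈ L¹` and every bounded Borel `g : ℝ³ → ℝ`,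
`∫ g(u(x)) det ∇u(x) dx = 0` — the signed velocity-space ("hodograph") measure `u_*(det ∇u dx)`
vanishes identically (classically: the Brouwer degree of `u` at every regular value `v ≠ 0` is
zero, by the area formula with multiplicity).

The proof here is degree-free. `HodographBetchovHodographConditioningMollify.lean` gives
`∫ f(u) det ∇u = 0` for smooth `f` vanishing near the origin of velocity space (null-Lagrangian
structure of the determinant + mollification + cutoff). This file finishes:

* `integral_comp_mul_det_eq_zero_of_continuous_of_vanishing` — continuous bounded `f` vanishing
  near the origin, by mollifying `f` (dominated convergence, `det ∇u ∈ L¹`);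
* `countable_zeroSet_inter_det_ne`, `indicator_zeroSet_mul_det_ae_eq_zero` — the zeros of `u`
  with `det ∇u ≠ 0` are isolated (inverse function theorem), hence countable, hence null: the
  origin of velocity space carries no hodograph mass;
* `integral_comp_mul_det_eq_zero_of_continuous` — all bounded continuous `f` (peel off a
  shrinking bump at the origin);
* `integral_comp_mul_det_eq_zero` — all bounded measurable `g`: the finite Borel measures
  `u_*((det ∇u)⁺ dx)` and `u_*((det ∇u)⁻ dx)` have the same integrals against bounded continuous
  functions, hence coincide (`ext_of_forall_integral_eq_of_IsFiniteMeasure`);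
* `hodographConditioning_proof` — the route item by name.

References: I. Fonseca, W. Gangbo, *Degree Theory in Analysis and Applications* (OUP 1995),
Ch. 5 (degree formula); L. C. Evans, R. F. Gariepy, *Measure Theory and Fine Properties of
Functions* (2015), §3.3–3.4 (area formula); J. M. Ball, Arch. Ration. Mech. Anal. 63 (1977), §3;
L. C. Evans, *Partial Differential Equations*, §8.1.4.b; R. Betchov, J. Fluid Mech. 1 (1956).
-/

noncomputable section

open MeasureTheory Set Function Filter Topology InnerProductSpace Metric
open scoped RealInnerProductSpace ContDiff ENNReal NNReal Convolution BoundedContinuousFunction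

-- the summit and its single sub-problem share the name (CONVENTIONS §1), as in every Theorems file
set_option linter.dupNamespace false

namespace Summit.NavierStokesRegularity.NavierStokesRegularity.Theorems

open Literature.Analysis Literature.Analysis.FluidPDE Literature.Analysis.FunctionSpaces

namespace HodographConditioning

/-! ### Step 5: continuous bounded weights vanishing near the origin -/

/-- For `V ∈ C¹(ℝ³; ℝ³)` tending to `0` at infinity with `det ∇V ∈ L¹`, and a bounded continuous
`f` vanishing on a ball around the origin of velocity space: `∫ f(V x) det ∇V(x) dx = 0`
(mollify `f`; the mollifications are smooth, vanish on a smaller ball, are uniformly bounded and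
converge pointwise; dominated convergence). [cite: Evans2010, §8.1.4.b and App. C.4] -/
theorem integral_comp_mul_det_eq_zero_of_continuous_of_vanishing
    {V : EuclideanSpace ℝ (Fin 3) → EuclideanSpace ℝ (Fin 3)} (hV : ContDiff ℝ 1 V)
    (h0 : Tendsto V (cocompact (EuclideanSpace ℝ (Fin 3))) (𝓝 0))
    (hJ : Integrable fun x => (fderiv ℝ V x).det)
    {f : EuclideanSpace ℝ (Fin 3) → ℝ} (hf : Continuous f) {M : ℝ} (hM : ∀ y, ‖f y‖ ≤ M)
    {a : ℝ} (ha : 0 < a) (hfa : ∀ y ∈ ball (0 : EuclideanSpace ℝ (Fin 3)) (2 * a), f y = 0) :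
    ∫ x, f (V x) * (fderiv ℝ V x).det = 0 := by
  have hM0 : 0 ≤ M := (norm_nonneg _).trans (hM 0)
  -- mollifiers of radius `≤ a`
  set φ : ℕ → ContDiffBump (0 : EuclideanSpace ℝ (Fin 3)) := fun n =>
    ⟨a / ((n : ℝ) + 2), a / ((n : ℝ) + 1), by positivity,
      div_lt_div_of_pos_left ha (by positivity) (by linarith)⟩ with hφ
  have hφout : ∀ n, (φ n).rOut = a / ((n : ℝ) + 1) := fun n => rfl
  have hφle : ∀ n, (φ n).rOut ≤ a := fun n => by
    rw [hφout, div_le_iff₀ (by positivity)]; nlinarith [n.cast_nonneg (α := ℝ)]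
  have hφ0 : Tendsto (fun n => (φ n).rOut) atTop (𝓝 0) := by
    simp_rw [hφout]
    have h := tendsto_one_div_add_atTop_nhds_zero_nat.const_mul a
    rw [mul_zero] at h
    refine h.congr fun n => ?_
    ring
  set fs : ℕ → EuclideanSpace ℝ (Fin 3) → ℝ := fun n =>
    (φ n).normed volume ⋆[ContinuousLinearMap.lsmul ℝ ℝ, volume] f with hfs
  have hfli : LocallyIntegrable f volume := hf.locallyIntegrable
  have hsmooth : ∀ n, ContDiff ℝ ∞ (fs n) := fun n =>
    (φ n).hasCompactSupport_normed.contDiff_convolution_left _ (φ n).contDiff_normed hfli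
  -- the mollifications vanish on `ball 0 a`
  have hvan : ∀ n, ∀ y ∈ ball (0 : EuclideanSpace ℝ (Fin 3)) a, fs n y = 0 := by
    intro n y hy
    have hy' := mem_ball_zero_iff.1 hy
    have hy0 : f y = 0 := hfa y (mem_ball_zero_iff.2 (by linarith))
    rw [hfs]
    dsimp only
    rw [ContDiffBump.normed_convolution_eq_right (fun z hz => ?_), hy0]
    rw [hy0]
    apply hfa
    rw [mem_ball_zero_iff]
    have h1 : ‖z - y‖ < a := by
      rw [← dist_eq_norm]; exact (mem_ball.1 hz).trans_le (hφle n)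
    calc ‖z‖ = ‖(z - y) + y‖ := by rw [sub_add_cancel]
      _ ≤ ‖z - y‖ + ‖y‖ := norm_add_le _ _
      _ < a + a := add_lt_add h1 hy'
      _ = 2 * a := by ring
  -- uniform bound and pointwise convergence
  have hbd : ∀ n y, ‖fs n y‖ ≤ M := fun n y =>
    norm_normed_convolution_le (φ n) hf.aestronglyMeasurable hM0 (fun z _ => hM z)
  have hlimf : ∀ y, Tendsto (fun n => fs n y) atTop (𝓝 (f y)) := fun y =>
    ContDiffBump.convolution_tendsto_right_of_continuous hφ0 hf y
  -- Step 4 for each mollification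
  have hzero : ∀ n, ∫ x, fs n (V x) * (fderiv ℝ V x).det = 0 := fun n =>
    integral_comp_mul_det_eq_zero_of_contDiff hV h0 (hsmooth n) ha (hvan n)
  -- dominated convergence
  have hcdet : Continuous fun x => (fderiv ℝ V x).det :=
    ContinuousLinearMap.continuous_det.comp (hV.continuous_fderiv one_ne_zero)
  set Fs : ℕ → EuclideanSpace ℝ (Fin 3) → ℝ := fun n x => fs n (V x) * (fderiv ℝ V x).det with hFs
  have hmeas : ∀ n, AEStronglyMeasurable (Fs n) volume := fun n =>
    (((hsmooth n).continuous.comp hV.continuous).mul hcdet).aestronglyMeasurable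
  have hbound : ∀ n, ∀ᵐ x ∂volume, ‖Fs n x‖ ≤ M * ‖(fderiv ℝ V x).det‖ := fun n =>
    Eventually.of_forall fun x => by
      rw [hFs]; dsimp only
      rw [norm_mul]
      exact mul_le_mul_of_nonneg_right (hbd n (V x)) (norm_nonneg _)
  have hbound_int : Integrable (fun x => M * ‖(fderiv ℝ V x).det‖) volume := hJ.norm.const_mul M
  have hlim : ∀ᵐ x ∂volume, Tendsto (fun n => Fs n x) atTop (𝓝 (f (V x) * (fderiv ℝ V x).det)) :=
    Eventually.of_forall fun x => (hlimf (V x)).mul tendsto_const_nhds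
  have hDCT := tendsto_integral_of_dominated_convergence _ hmeas hbound_int hbound hlim
  have h0' : Tendsto (fun n => ∫ x, Fs n x) atTop (𝓝 0) := by
    simp_rw [hFs, hzero]; exact tendsto_const_nhds
  exact tendsto_nhds_unique hDCT h0'

/-! ### Step 6: the origin of velocity space carries no mass -/

/-- The zeros of a `C¹` field at which the Jacobian determinant does not vanish form a discrete,
hence countable, set (inverse function theorem: the field is injective near such a zero).
[folklore] -/
theorem countable_zeroSet_inter_det_ne
    {V : EuclideanSpace ℝ (Fin 3) → EuclideanSpace ℝ (Fin 3)} (hV : ContDiff ℝ 1 V) :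
    ({x | V x = 0 ∧ (fderiv ℝ V x).det ≠ 0} : Set (EuclideanSpace ℝ (Fin 3))).Countable := by
  refine (HereditarilyLindelofSpace.isLindelof _).countable_of_isDiscrete
    (IsDiscrete.of_nhdsWithin ?_)
  rintro x ⟨hx0, hxd⟩
  set e := (fderiv ℝ V x).toContinuousLinearEquivOfDetNeZero hxd with he
  have hsd : HasStrictFDerivAt V (e : EuclideanSpace ℝ (Fin 3) →L[ℝ] EuclideanSpace ℝ (Fin 3)) x := by
    rw [he, ContinuousLinearMap.coe_toContinuousLinearEquivOfDetNeZero]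
    exact hV.contDiffAt.hasStrictFDerivAt one_ne_zero
  rw [Filter.le_pure_iff, mem_nhdsWithin_iff_eventually]
  filter_upwards [hsd.eventually_left_inverse] with y hy hyZ
  rw [mem_singleton_iff]
  calc y = hsd.localInverse V e x (V y) := hy.symm
    _ = hsd.localInverse V e x (V x) := by rw [hyZ.1, hx0]
    _ = x := hsd.localInverse_apply_image

/-- Consequently `1_{V = 0} · F · det ∇V = 0` almost everywhere, for any `F`. [folklore] -/
theorem indicator_zeroSet_mul_det_ae_eq_zero
    {V : EuclideanSpace ℝ (Fin 3) → EuclideanSpace ℝ (Fin 3)} (hV : ContDiff ℝ 1 V)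
    (F : EuclideanSpace ℝ (Fin 3) → ℝ) :
    (fun x => ({x | V x = 0} : Set (EuclideanSpace ℝ (Fin 3))).indicator
        (fun x => F x * (fderiv ℝ V x).det) x) =ᵐ[volume] (0 : EuclideanSpace ℝ (Fin 3) → ℝ) := by
  have hZ0 : volume ({x | V x = 0 ∧ (fderiv ℝ V x).det ≠ 0} : Set (EuclideanSpace ℝ (Fin 3))) = 0 :=
    (countable_zeroSet_inter_det_ne hV).measure_zero volume
  filter_upwards [measure_eq_zero_iff_ae_notMem.1 hZ0] with x hx
  by_cases hVx : V x = 0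
  · rw [indicator_of_mem (show x ∈ {x | V x = 0} from hVx)]
    have hdet : (fderiv ℝ V x).det = 0 := by
      by_contra hne
      exact hx ⟨hVx, hne⟩
    simp [hdet]
  · rw [indicator_of_notMem (show x ∉ {x | V x = 0} from hVx)]
    rfl

/-! ### Step 7: all bounded continuous weights -/

/-- For `V ∈ C¹(ℝ³; ℝ³)` tending to `0` at infinity with `det ∇V ∈ L¹` and every bounded continuous
`f`: `∫ f(V x) det ∇V(x) dx = 0`. Write `f = f (1 − ψₙ) + f ψₙ` with bumps `ψₙ` shrinking to the
origin: the first part vanishes near the origin (Step 5), the second tends to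
`1_{V=0} f(0) det ∇V`, which is a.e. zero (Step 6). [cite: Evans2010, §8.1.4.b] -/
theorem integral_comp_mul_det_eq_zero_of_continuous
    {V : EuclideanSpace ℝ (Fin 3) → EuclideanSpace ℝ (Fin 3)} (hV : ContDiff ℝ 1 V)
    (h0 : Tendsto V (cocompact (EuclideanSpace ℝ (Fin 3))) (𝓝 0))
    (hJ : Integrable fun x => (fderiv ℝ V x).det)
    {f : EuclideanSpace ℝ (Fin 3) → ℝ} (hf : Continuous f) {M : ℝ} (hM : ∀ y, ‖f y‖ ≤ M) :
    ∫ x, f (V x) * (fderiv ℝ V x).det = 0 := by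
  have hM0 : 0 ≤ M := (norm_nonneg _).trans (hM 0)
  have hcdet : Continuous fun x => (fderiv ℝ V x).det :=
    ContinuousLinearMap.continuous_det.comp (hV.continuous_fderiv one_ne_zero)
  -- integrability of `g(V) det ∇V` for bounded continuous `g`
  have hint : ∀ g : EuclideanSpace ℝ (Fin 3) → ℝ, Continuous g → (∀ y, ‖g y‖ ≤ M) →
      Integrable (fun x => g (V x) * (fderiv ℝ V x).det) volume := fun g hg hgM =>
    hJ.bdd_mul (hg.comp hV.continuous).aestronglyMeasurable (Eventually.of_forall fun x => hgM (V x))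
  -- the shrinking bumps at the origin of velocity space
  set ψ : ℕ → ContDiffBump (0 : EuclideanSpace ℝ (Fin 3)) := fun n =>
    ⟨2 / ((n : ℝ) + 1), 3 / ((n : ℝ) + 1), by positivity,
      div_lt_div_of_pos_right (by norm_num) (by positivity)⟩ with hψ
  have hψ1 : ∀ n y, ‖1 - ψ n y‖ ≤ 1 := fun n y => by
    rw [Real.norm_eq_abs, abs_of_nonneg (sub_nonneg.2 (ψ n).le_one)]
    linarith [(ψ n).nonneg (x := y)]
  have hψ2 : ∀ n y, ‖ψ n y‖ ≤ 1 := fun n y => by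
    rw [Real.norm_eq_abs, abs_of_nonneg (ψ n).nonneg]; exact (ψ n).le_one
  -- `∫ f(V) det = ∫ f(V) ψₙ(V) det` for every `n`
  have hsplit : ∀ n, ∫ x, f (V x) * (fderiv ℝ V x).det =
      ∫ x, (f (V x) * ψ n (V x)) * (fderiv ℝ V x).det := by
    intro n
    have h1 : ∫ x, (f (V x) * (1 - ψ n (V x))) * (fderiv ℝ V x).det = 0 := by
      refine integral_comp_mul_det_eq_zero_of_continuous_of_vanishing hV h0 hJ
        (f := fun y => f y * (1 - ψ n y)) (hf.mul (continuous_const.sub (ψ n).continuous))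
        (M := M) (fun y => ?_) (a := 1 / ((n : ℝ) + 1)) (by positivity) (fun y hy => ?_)
      · rw [norm_mul]
        calc ‖f y‖ * ‖1 - ψ n y‖ ≤ M * 1 := mul_le_mul (hM y) (hψ1 n y) (norm_nonneg _) hM0
          _ = M := mul_one M
      · have hy1 : ψ n y = 1 := by
          apply (ψ n).one_of_mem_closedBall
          rw [mem_closedBall_zero_iff]
          have hy' := mem_ball_zero_iff.1 hy
          have : (2 : ℝ) * (1 / ((n : ℝ) + 1)) = 2 / ((n : ℝ) + 1) := by ring
          change ‖y‖ ≤ 2 / ((n : ℝ) + 1)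
          linarith
        simp [hy1]
    have hadd : (fun x => f (V x) * (fderiv ℝ V x).det) = fun x =>
        (f (V x) * (1 - ψ n (V x))) * (fderiv ℝ V x).det +
          (f (V x) * ψ n (V x)) * (fderiv ℝ V x).det := by
      funext x; ring
    rw [hadd, integral_add, h1, zero_add]
    · exact hint (fun y => f y * (1 - ψ n y)) (hf.mul (continuous_const.sub (ψ n).continuous))
        (fun y => by
          rw [norm_mul]
          calc ‖f y‖ * ‖1 - ψ n y‖ ≤ M * 1 := mul_le_mul (hM y) (hψ1 n y) (norm_nonneg _) hM0
            _ = M := mul_one M)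
    · exact hint (fun y => f y * ψ n y) (hf.mul (ψ n).continuous)
        (fun y => by
          rw [norm_mul]
          calc ‖f y‖ * ‖ψ n y‖ ≤ M * 1 := mul_le_mul (hM y) (hψ2 n y) (norm_nonneg _) hM0
            _ = M := mul_one M)
  -- `∫ f(V) ψₙ(V) det → ∫ 1_{V=0} f(V) det = 0`
  have hlim : Tendsto (fun n => ∫ x, (f (V x) * ψ n (V x)) * (fderiv ℝ V x).det) atTop (𝓝 0) := by
    have hmeas : ∀ n, AEStronglyMeasurable
        (fun x => (f (V x) * ψ n (V x)) * (fderiv ℝ V x).det) volume := fun n =>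
      ((((hf.mul (ψ n).continuous)).comp hV.continuous).mul hcdet).aestronglyMeasurable
    have hbound : ∀ n, ∀ᵐ x ∂volume,
        ‖(f (V x) * ψ n (V x)) * (fderiv ℝ V x).det‖ ≤ M * ‖(fderiv ℝ V x).det‖ := fun n =>
      Eventually.of_forall fun x => by
        rw [norm_mul, norm_mul]
        refine mul_le_mul_of_nonneg_right ?_ (norm_nonneg _)
        calc ‖f (V x)‖ * ‖ψ n (V x)‖ ≤ M * 1 :=
            mul_le_mul (hM _) (hψ2 n _) (norm_nonneg _) hM0
          _ = M := mul_one M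
    have hptw : ∀ᵐ x ∂volume, Tendsto (fun n => (f (V x) * ψ n (V x)) * (fderiv ℝ V x).det) atTop
        (𝓝 (({x | V x = 0} : Set (EuclideanSpace ℝ (Fin 3))).indicator
          (fun x => f (V x) * (fderiv ℝ V x).det) x)) := by
      refine Eventually.of_forall fun x => ?_
      by_cases hVx : V x = 0
      · rw [indicator_of_mem (show x ∈ {x | V x = 0} from hVx)]
        have h1 : ∀ n, ψ n (V x) = 1 := fun n => by
          rw [hVx]; exact (ψ n).one_of_mem_closedBall (mem_closedBall_self (ψ n).rIn_pos.le)
        simp_rw [h1, mul_one]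
        exact tendsto_const_nhds
      · rw [indicator_of_notMem (show x ∉ {x | V x = 0} from hVx)]
        have hpos : 0 < ‖V x‖ := norm_pos_iff.2 hVx
        obtain ⟨N, hN⟩ := exists_nat_gt (3 / ‖V x‖)
        refine tendsto_const_nhds.congr' ?_
        filter_upwards [eventually_ge_atTop N] with n hn
        have hψ0 : ψ n (V x) = 0 := by
          apply (ψ n).zero_of_le_dist
          rw [dist_zero_right]
          change 3 / ((n : ℝ) + 1) ≤ ‖V x‖
          rw [div_le_iff₀ (by positivity)]
          have h1 : 3 / ‖V x‖ < (n : ℝ) + 1 := by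
            have := (Nat.cast_le (α := ℝ)).2 hn
            linarith
          rw [div_lt_iff₀ hpos] at h1
          linarith
        rw [hψ0, mul_zero, zero_mul]
    have hDCT := tendsto_integral_of_dominated_convergence _ hmeas (hJ.norm.const_mul M) hbound hptw
    have hae : (fun x => ({x | V x = 0} : Set (EuclideanSpace ℝ (Fin 3))).indicator
        (fun x => f (V x) * (fderiv ℝ V x).det) x) =ᵐ[volume] (0 : EuclideanSpace ℝ (Fin 3) → ℝ) :=
      indicator_zeroSet_mul_det_ae_eq_zero hV (fun y => f (V y))
    rw [integral_congr_ae hae] at hDCT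
    simpa using hDCT
  -- conclude: the constant sequence `∫ f(V) det` tends to `0`
  have hconst : Tendsto (fun n : ℕ => ∫ x, f (V x) * (fderiv ℝ V x).det) atTop (𝓝 0) :=
    hlim.congr' (Eventually.of_forall fun n => (hsplit n).symm)
  exact tendsto_nhds_unique tendsto_const_nhds hconst

/-! ### Step 8: all bounded measurable weights (uniqueness of finite Borel measures) -/

/-- **The hodograph identity for `C¹` fields.** For `V ∈ C¹(ℝ³; ℝ³)` tending to `0` at infinity
with `det ∇V ∈ L¹`, and every bounded measurable `g : ℝ³ → ℝ`: `∫ g(V x) det ∇V(x) dx = 0`.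
The finite Borel measures `V_*((det ∇V)^± dx)` on velocity space integrate every bounded
continuous function identically (Step 7), hence coincide, hence integrate `g` identically.
[cite: FonsecaGangbo1995, Ch. 5 (degree formula; here proved degree-free)] -/
theorem integral_comp_mul_det_eq_zero
    {V : EuclideanSpace ℝ (Fin 3) → EuclideanSpace ℝ (Fin 3)} (hV : ContDiff ℝ 1 V)
    (h0 : Tendsto V (cocompact (EuclideanSpace ℝ (Fin 3))) (𝓝 0))
    (hJ : Integrable fun x => (fderiv ℝ V x).det)
    {g : EuclideanSpace ℝ (Fin 3) → ℝ} (hg : Measurable g) {M : ℝ} (hM : ∀ y, |g y| ≤ M) :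
    ∫ x, g (V x) * (fderiv ℝ V x).det = 0 := by
  have hcJ : Continuous fun x => (fderiv ℝ V x).det :=
    ContinuousLinearMap.continuous_det.comp (hV.continuous_fderiv one_ne_zero)
  have hmJ : Measurable fun x => (fderiv ℝ V x).det := hcJ.measurable
  have hVm : AEMeasurable V volume := hV.continuous.measurable.aemeasurable
  -- the densities `(det ∇V)⁺`, `(det ∇V)⁻`
  set Dp : EuclideanSpace ℝ (Fin 3) → ℝ≥0 := fun x => Real.toNNReal ((fderiv ℝ V x).det) with hDp
  set Dm : EuclideanSpace ℝ (Fin 3) → ℝ≥0 := fun x => Real.toNNReal (-(fderiv ℝ V x).det) with hDm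
  have hDpm : Measurable Dp := hmJ.real_toNNReal
  have hDmm : Measurable Dm := hmJ.neg.real_toNNReal
  have hIp : Integrable (fun x => (Dp x : ℝ)) volume := hJ.real_toNNReal
  have hIm : Integrable (fun x => (Dm x : ℝ)) volume := hJ.neg.real_toNNReal
  -- the weighted measures and their push-forwards to velocity space
  set νp : Measure (EuclideanSpace ℝ (Fin 3)) := volume.withDensity fun x => (Dp x : ℝ≥0∞) with hνp
  set νm : Measure (EuclideanSpace ℝ (Fin 3)) := volume.withDensity fun x => (Dm x : ℝ≥0∞) with hνm
  haveI hfp : IsFiniteMeasure νp := isFiniteMeasure_withDensity_ofReal hJ.hasFiniteIntegral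
  haveI hfm : IsFiniteMeasure νm := isFiniteMeasure_withDensity_ofReal hJ.neg.hasFiniteIntegral
  set μp : Measure (EuclideanSpace ℝ (Fin 3)) := νp.map V with hμp
  set μm : Measure (EuclideanSpace ℝ (Fin 3)) := νm.map V with hμm
  -- integrals against the push-forwards
  have hVp : AEMeasurable V νp := hV.continuous.measurable.aemeasurable
  have hVm' : AEMeasurable V νm := hV.continuous.measurable.aemeasurable
  have hpush : ∀ (k : EuclideanSpace ℝ (Fin 3) → ℝ), Measurable k →
      (∫ y, k y ∂μp = ∫ x, (Dp x : ℝ) * k (V x)) ∧ (∫ y, k y ∂μm = ∫ x, (Dm x : ℝ) * k (V x)) := by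
    intro k hk
    constructor
    · rw [hμp, integral_map hVp hk.aestronglyMeasurable, hνp,
        integral_withDensity_eq_integral_smul hDpm]
      simp only [NNReal.smul_def, smul_eq_mul]
    · rw [hμm, integral_map hVm' hk.aestronglyMeasurable, hνm,
        integral_withDensity_eq_integral_smul hDmm]
      simp only [NNReal.smul_def, smul_eq_mul]
  -- integrability of `D± · k(V)` for bounded measurable `k`
  have hintk : ∀ (k : EuclideanSpace ℝ (Fin 3) → ℝ), Measurable k → ∀ C : ℝ, (∀ y, ‖k y‖ ≤ C) →
      Integrable (fun x => (Dp x : ℝ) * k (V x)) volume ∧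
        Integrable (fun x => (Dm x : ℝ) * k (V x)) volume := by
    intro k hk C hC
    have hkm : AEStronglyMeasurable (fun x => k (V x)) volume :=
      (hk.comp hV.continuous.measurable).aestronglyMeasurable
    exact ⟨hIp.mul_bdd hkm (Eventually.of_forall fun x => hC (V x)),
      hIm.mul_bdd hkm (Eventually.of_forall fun x => hC (V x))⟩
  -- the pointwise split `det = det⁺ − det⁻`
  have hsplit : ∀ (k : EuclideanSpace ℝ (Fin 3) → ℝ) (x : EuclideanSpace ℝ (Fin 3)),
      (Dp x : ℝ) * k (V x) - (Dm x : ℝ) * k (V x) = k (V x) * (fderiv ℝ V x).det := by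
    intro k x
    rw [hDp, hDm]
    dsimp only
    rw [← sub_mul, Real.coe_toNNReal', Real.coe_toNNReal', max_zero_sub_max_neg_zero_eq_self,
      mul_comm]
  -- the two push-forwards coincide
  have hkey : μp = μm := by
    haveI : IsFiniteMeasure μp := by rw [hμp]; infer_instance
    haveI : IsFiniteMeasure μm := by rw [hμm]; infer_instance
    refine ext_of_forall_integral_eq_of_IsFiniteMeasure (fun φ => ?_)
    have hφm : Measurable (φ : EuclideanSpace ℝ (Fin 3) → ℝ) := φ.continuous.measurable
    rw [(hpush φ hφm).1, (hpush φ hφm).2, ← sub_eq_zero,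
      ← integral_sub ((hintk φ hφm ‖φ‖ (fun y => φ.norm_coe_le_norm y)).1)
        ((hintk φ hφm ‖φ‖ (fun y => φ.norm_coe_le_norm y)).2)]
    simp_rw [hsplit φ]
    exact integral_comp_mul_det_eq_zero_of_continuous hV h0 hJ φ.continuous
      (fun y => φ.norm_coe_le_norm y)
  -- conclusion for the bounded measurable weight `g`
  have hgM : ∀ y, ‖g y‖ ≤ M := fun y => by rw [Real.norm_eq_abs]; exact hM y
  have hdecomp : (fun x => g (V x) * (fderiv ℝ V x).det) =
      fun x => (Dp x : ℝ) * g (V x) - (Dm x : ℝ) * g (V x) := by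
    funext x; exact (hsplit g x).symm
  rw [hdecomp, integral_sub (hintk g hg M hgM).1 (hintk g hg M hgM).2, ← (hpush g hg).1,
    ← (hpush g hg).2, hkey, sub_self]

end HodographConditioning

/-- **Support item `HodographConditioning` of route `HodographBetchov`
(stmt-NavierStokesRegularity-15834), proved.** For `u ∈ C¹(ℝ³; ℝ³)` tending to `0` at infinity
with `det ∇u ∈ L¹` and every bounded Borel `g`, `∫ g(u(x)) det ∇u(x) dx = 0`: the velocity-space
hodograph measure `u_*(det ∇u dx)` vanishes. Degree-free proof: null-Lagrangian structure of the
determinant for `C²` fields, mollification to `C¹`, cutoff at infinity, removal of the origin by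
the inverse function theorem, and uniqueness of finite Borel measures.
[cite: FonsecaGangbo1995, Ch. 5; Evans2010, §8.1.4.b] -/
theorem hodographConditioning_proof :
    Summit.NavierStokesRegularity.NavierStokesRegularity.Theses.HodographBetchov.HodographConditioning := by
  unfold Summit.NavierStokesRegularity.NavierStokesRegularity.Theses.HodographBetchov.HodographConditioning
  intro u hu h0 hint g hg hgb
  obtain ⟨B, hB⟩ := hgb
  exact HodographConditioning.integral_comp_mul_det_eq_zero hu h0 hint hg hB

end Summit.NavierStokesRegularity.NavierStokesRegularity.Theorems

end
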